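import Mathlib
import Summits.Ventures.HodgeRepro2.T5DyadicExamples

/-!
# T5CubicRamification — the ramified primes of a cubic subfield of `ℚ(ζ_n)` are `3` or `≡ 1 (mod 3)`;
`2` never ramifies

Tier-5 support (seat p3) for sub-step N2 of `route/T5-N2-route-3.md`, §N2.8.2(b): «2 NEVER
RAMIFIES in F⁺: the conductor of a cyclic cubic field is a product of distinct primes ≡ 1 (mod 3)
and possibly 9 (conductor–discriminant; Kronecker–Weber), so 2 is inert (g₂ = 1) … or splits
completely (g₂ = 3)».

The record's chain is: Kronecker–Weber embeds `F⁺` in some `ℚ(ζ_n)`; the conductor shape then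
says which primes ramify.  `T5CyclotomicUnramified` (p394623) treated the primes `p ∤ n`.  THIS file
treats the ramified primes themselves: for ANY `n`, ANY `E` with `IsCyclotomicExtension {n} ℚ E` and
ANY cubic intermediate field `F` of `E/ℚ`,

* a prime `p` ramified in `F` is TOTALLY ramified (`e = 3`) and satisfies `p = 3` or `p ≡ 1 (mod 3)`
  (`eq_three_or_mod_three_eq_one_of_ramified`): `e(𝔭|p)` divides `[F : ℚ] = 3` (Galois identity for
  `F/ℚ`, which is Galois since `E/ℚ` is abelian — `IsCyclotomicExtension.isAbelianGalois`,
  `IsAbelianGalois.tower_bot`) and divides `e(P|p) = p^k (p − 1)` for `n = p^{k+1} m`, `p ∤ m`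
  (`IsCyclotomicExtension.Rat.ramificationIdx_eq`, `Ideal.ramificationIdx_below_dvd`); for `p ∤ n`
  it is `1` (`ramificationIdx_eq_of_not_dvd`);
* hence `2` is unramified in EVERY cubic subfield of EVERY `ℚ(ζ_n)` — `n` even or odd
  (`ramificationIdx_two_eq_one`) — and `2` is inert or splits completely there
  (`inert_or_splitsCompletely_two`): N2.8.2(b) in full, modulo the Kronecker–Weber embedding.

Honest scope — stays prose: Kronecker–Weber itself (that a cyclic cubic `F⁺` embeds in some
`ℚ(ζ_n)`); completions.  Uses an L-value-free non-vanishing device: NO (README §8(d)).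
-/

namespace Summit.Ventures.HodgeRepro2.T5CubicRamification

open Ideal NumberField

variable (n : ℕ) [NeZero n] (p : ℕ) [Fact p.Prime] (E : Type*) [Field E] [NumberField E]
  [IsCyclotomicExtension {n} ℚ E] (F : IntermediateField ℚ E)

include n

/-- The ideal `(p)` of `ℤ` (maximal: `Int.ideal_span_isMaximal_of_prime`). -/
local notation3 "𝒑" => (span {(p : ℤ)} : Ideal ℤ)

omit [NeZero n] in
/-- Every intermediate field of `ℚ(ζ_n)` is Galois over `ℚ` (`ℚ(ζ_n)/ℚ` is abelian:
`IsCyclotomicExtension.isAbelianGalois`, `IsAbelianGalois.tower_bot`). -/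
theorem isGalois_of_isCyclotomicExtension : IsGalois ℚ F :=
  haveI : IsAbelianGalois ℚ E := IsCyclotomicExtension.isAbelianGalois {n} ℚ E
  (IsAbelianGalois.tower_bot ℚ F E).toIsGalois

omit [NeZero n] in
/-- The Galois fundamental identity for `F/ℚ` read off one prime `𝔭` above `p`:
`#{𝔭 | p}·(e·f) = [F : ℚ]`. -/
theorem ncard_primesOver_mul (𝔭 : Ideal (𝓞 F)) [𝔭.IsPrime] [𝔭.LiesOver 𝒑] :
    (𝒑.primesOver (𝓞 F)).ncard * (𝔭.ramificationIdx ℤ * 𝔭.inertiaDeg ℤ) =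
      Module.finrank ℚ F := by
  haveI : IsGalois ℚ F := isGalois_of_isCyclotomicExtension n E F
  rw [← IsGaloisGroup.card_eq_finrank (F ≃ₐ[ℚ] F) ℚ F,
    ← ncard_primesOver_mul_ramificationIdxIn_mul_inertiaDegIn 𝒑 (𝓞 F) (F ≃ₐ[ℚ] F),
    ramificationIdxIn_eq_ramificationIdx 𝒑 𝔭 (F ≃ₐ[ℚ] F),
    inertiaDegIn_eq_inertiaDeg 𝒑 𝔭 (F ≃ₐ[ℚ] F)]

omit [NeZero n] in
/-- The ramification index of a prime of `F` above `p` divides `[F : ℚ]`. -/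
theorem ramificationIdx_dvd_finrank (𝔭 : Ideal (𝓞 F)) [𝔭.IsPrime] [𝔭.LiesOver 𝒑] :
    𝔭.ramificationIdx ℤ ∣ Module.finrank ℚ F := by
  refine ⟨(𝒑.primesOver (𝓞 F)).ncard * 𝔭.inertiaDeg ℤ, ?_⟩
  rw [← ncard_primesOver_mul n p E F 𝔭]
  ring

omit [NeZero n] in
/-- For `n = p^{k+1} m` with `p ∤ m`, the ramification index of a prime of `F` above `p` divides
`e(P|p) = p^k (p − 1)`, the ramification index of `p` in `ℚ(ζ_n)`
(`IsCyclotomicExtension.Rat.ramificationIdx_eq`, `Ideal.ramificationIdx_below_dvd`). -/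
theorem ramificationIdx_dvd_of_eq {m k : ℕ} (hn : n = p ^ (k + 1) * m) (hm : ¬ p ∣ m)
    (𝔭 : Ideal (𝓞 F)) [𝔭.IsPrime] [𝔭.LiesOver 𝒑] :
    𝔭.ramificationIdx ℤ ∣ p ^ k * (p - 1) := by
  obtain ⟨⟨P, hP, hPF⟩⟩ := 𝔭.nonempty_primesOver (S := 𝓞 E)
  haveI : P.LiesOver 𝒑 := LiesOver.trans P 𝔭 𝒑
  rw [← IsCyclotomicExtension.Rat.ramificationIdx_eq n E P hn hm]
  exact ramificationIdx_below_dvd (R := ℤ) 𝔭 P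

/-- `p ∤ n` ⟹ `p` is unramified in `F` (as in `T5CyclotomicUnramified`, restated here for
`n` with `NeZero n` in place of `¬ p ∣ m`). -/
theorem ramificationIdx_eq_one_of_not_dvd (hn : ¬ p ∣ n) (𝔭 : Ideal (𝓞 F)) [𝔭.IsPrime]
    [𝔭.LiesOver 𝒑] : 𝔭.ramificationIdx ℤ = 1 := by
  obtain ⟨⟨P, hP, hPF⟩⟩ := 𝔭.nonempty_primesOver (S := 𝓞 E)
  haveI : P.LiesOver 𝒑 := LiesOver.trans P 𝔭 𝒑
  have h := ramificationIdx_tower (R := ℤ) 𝔭 P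
  rw [IsCyclotomicExtension.Rat.ramificationIdx_eq_of_not_dvd (m := n) p E P hn] at h
  exact Nat.eq_one_of_mul_eq_one_right h.symm

omit [NeZero n] in
/-- In a CUBIC subfield, a ramified prime is TOTALLY ramified: `e ∣ 3` and `e ≠ 1` force `e = 3`. -/
theorem ramificationIdx_eq_three_of_ne_one (hF : Module.finrank ℚ F = 3) (𝔭 : Ideal (𝓞 F))
    [𝔭.IsPrime] [𝔭.LiesOver 𝒑] (h : 𝔭.ramificationIdx ℤ ≠ 1) : 𝔭.ramificationIdx ℤ = 3 := by
  have hd := ramificationIdx_dvd_finrank n p E F 𝔭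
  rw [hF] at hd
  rcases (Nat.dvd_prime Nat.prime_three).mp hd with h1 | h3
  · exact absurd h1 h
  · exact h3

/-- THE CONDUCTOR SHAPE, ramification half: a prime `p` ramified in a cubic subfield of `ℚ(ζ_n)`
is `3` or `≡ 1 (mod 3)` — `3 = e(𝔭|p)` divides `p^k (p − 1)`, so `3 ∣ p` or `3 ∣ p − 1`. -/
theorem eq_three_or_mod_three_eq_one_of_ramified (hF : Module.finrank ℚ F = 3)
    (𝔭 : Ideal (𝓞 F)) [𝔭.IsPrime] [𝔭.LiesOver 𝒑] (h : 𝔭.ramificationIdx ℤ ≠ 1) :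
    p = 3 ∨ p % 3 = 1 := by
  have hp := (Fact.out : p.Prime)
  have he := ramificationIdx_eq_three_of_ne_one n p E F hF 𝔭 h
  -- `p ∣ n`, otherwise `p` is unramified
  have hpn : p ∣ n := by
    by_contra hpn
    exact h (ramificationIdx_eq_one_of_not_dvd n p E F hpn 𝔭)
  obtain ⟨k, m, hm, hn⟩ := Nat.exists_eq_pow_mul_and_not_dvd (NeZero.ne n) p hp.ne_one
  cases k with
  | zero =>
    exfalso
    rw [pow_zero, one_mul] at hn
    exact hm (hn ▸ hpn)
  | succ k =>
    have h3 : 3 ∣ p ^ k * (p - 1) := he ▸ ramificationIdx_dvd_of_eq n p E F hn hm 𝔭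
    rcases (Nat.Prime.dvd_mul Nat.prime_three).mp h3 with h3p | h3p
    · left
      have : 3 ∣ p := Nat.prime_three.dvd_of_dvd_pow h3p
      exact ((Nat.prime_dvd_prime_iff_eq Nat.prime_three hp).mp this).symm
    · right
      have hp2 := hp.two_le
      omega

/-- `2` NEVER RAMIFIES in a cubic subfield of `ℚ(ζ_n)`, for EVERY `n` (`2 ≠ 3` and `2 ≢ 1 (mod 3)`):
N2.8.2(b)'s first sentence, modulo the Kronecker–Weber embedding. -/
theorem ramificationIdx_two_eq_one (hF : Module.finrank ℚ F = 3) (𝔭 : Ideal (𝓞 F)) [𝔭.IsPrime]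
    [𝔭.LiesOver (span {((2 : ℕ) : ℤ)} : Ideal ℤ)] : 𝔭.ramificationIdx ℤ = 1 := by
  by_contra h
  rcases eq_three_or_mod_three_eq_one_of_ramified n 2 E F hF 𝔭 h with h2 | h2 <;> omega

/-- N2.8.2(b)'s dichotomy for EVERY `n`: in a cubic subfield of `ℚ(ζ_n)`, `2` is INERT (`f = 3`,
one prime above `2`) or SPLITS COMPLETELY (`f = 1`, three primes) — from `#{𝔭 | 2}·(1·f) = 3`
through `T5DyadicExamples.inert_or_split_of_unramified`. -/
theorem inert_or_splitsCompletely_two (hF : Module.finrank ℚ F = 3) (𝔭 : Ideal (𝓞 F))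
    [𝔭.IsPrime] [𝔭.LiesOver (span {((2 : ℕ) : ℤ)} : Ideal ℤ)] :
    (𝔭.inertiaDeg ℤ = 3 ∧ ((span {((2 : ℕ) : ℤ)} : Ideal ℤ).primesOver (𝓞 F)).ncard = 1) ∨
      (𝔭.inertiaDeg ℤ = 1 ∧ ((span {((2 : ℕ) : ℤ)} : Ideal ℤ).primesOver (𝓞 F)).ncard = 3) := by
  have h := ncard_primesOver_mul n 2 E F 𝔭
  rw [hF] at h
  have h3 : 𝔭.ramificationIdx ℤ * 𝔭.inertiaDeg ℤ *
      ((span {((2 : ℕ) : ℤ)} : Ideal ℤ).primesOver (𝓞 F)).ncard = 3 := by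
    rw [← h]; ring
  exact T5DyadicExamples.inert_or_split_of_unramified h3 (ramificationIdx_two_eq_one n E F hF 𝔭)

end Summit.Ventures.HodgeRepro2.T5CubicRamification
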